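import Literature.Analysis.FluidPDE.SereginSverak2002FinalMoment
import HarnessLib

/-!
# Seregin–Šverák 2002: no blow-up when the final value carries no scaled energy concentration

Analysis/FluidPDE proof file (theorems only; no definitions, no named facts), sequel of
`SereginSverak2002FinalMoment.lean` on the item `Literature.Analysis.FluidPDE.seregin_sverak_2002`
(G. Seregin, V. Šverák, Arch. Ration. Mech. Anal. **163** (2002) 65–86, Thm. 2.2 p. 70).

The printed proof uses the one-sided hypothesis AT the putative singular time `t₀` exactly once,
to obtain (pp. 80–81, (4.8)–(4.9) at `t₀`; p. 84, (4.13) at `t₀`) the smallness at small scales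
of the scaled energy OF THE FINAL-TIME FIELD,

  `(FE)  r⁻¹ ∫_{B(x₀, r)} |v(x, t₀)|² dx → 0` as `r → 0⁺`

((4.8) at `t₀`: `(2R)⁻¹ ∫_{B(x₀,R)} |v(t₀)|² ≤ Φ_{t₀}(R)`, an integral over `B(x₀, R)` of a
nonnegative integrable function), after which only times `t < t₀` enter. This file proves the
printed conclusion from EITHER one-sided bound on `(0, T) × ℝ³` plus (FE) for the final value
`u(T)` at every point — the weakest explicit form of the final-time input, implied by the
final-moment condition (FM) of the prequel and scale invariant. Route as in the prequel: under
(FE) the zooms `R u(T, x₀ + R ·)` tend to zero strongly in `L²_loc`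
(`∫_{B(0,a)} |R u(T, x₀ + R y)|² dy = R⁻¹ ∫_{B(x₀,aR)} |u(T)|² = a · (aR)⁻¹ ∫_{B(x₀,aR)} |u(T)|²`),
so every blow-up limit at the vertex `(T, x₀)` vanishes weakly at its final time
(`zoom_pairing_modulus`), and `isBackwardBoundedAt_top_of_weakVanishing` applies.

## Contents (namespace `Literature.Analysis.FluidPDE.SereginSverak2002`)

* `tendsto_lintegral_ball_zoom_of_scaledEnergy`, `tendsto_integral_inner_zoom_of_scaledEnergy`;
* `ae_abs_pairing_le_near_top_of_scaledEnergy`, `isBackwardBoundedAt_top_of_scaledEnergy`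
  (`ν = 1`), `isBackwardBoundedAt_of_scaledEnergy` (`ν > 0`, `t₀ ∈ (0, T]`);
* `Literature.Analysis.FluidPDE.seregin_sverak_2002_of_finalScaledEnergy` — the global form.

## References

* G. Seregin, V. Šverák, Arch. Ration. Mech. Anal. 163 (2002) 65–86: Thm. 2.2 (p. 70), §4
  (4.8)–(4.9) (pp. 79–81), (4.13) (p. 84). [SereginSverak2002]
-/

noncomputable section

open MeasureTheory TopologicalSpace Set Function Filter Topology Metric InnerProductSpace Real
open scoped ENNReal NNReal RealInnerProductSpace ContDiff

namespace Literature.Analysis.FluidPDE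

namespace SereginSverak2002

variable {T : ℝ} {u : ℝ → EuclideanSpace ℝ (Fin 3) → EuclideanSpace ℝ (Fin 3)}
  {p : ℝ → EuclideanSpace ℝ (Fin 3) → ℝ}

/-! ### Zooms of a field without scaled energy concentration vanish -/

/-- `∫⁻_{B(x₀,r)} ‖b‖ₑ² = ofReal (∫_{B(x₀,r)} ‖b‖²)` for `b ∈ L²`. [folklore] -/
theorem lintegral_ball_enorm_sq_eq_ofReal {b : EuclideanSpace ℝ (Fin 3) → EuclideanSpace ℝ (Fin 3)}
    (hb2 : MemLp b 2 volume) (x₀ : EuclideanSpace ℝ (Fin 3)) (r : ℝ) :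
    ∫⁻ x in ball x₀ r, ‖b x‖ₑ ^ 2 = ENNReal.ofReal (∫ x in ball x₀ r, ‖b x‖ ^ 2) := by
  have hi : Integrable (fun x => ‖b x‖ ^ 2) volume := hb2.integrable_norm_pow two_ne_zero
  rw [ofReal_integral_eq_lintegral_ofReal hi.integrableOn (Eventually.of_forall fun x => sq_nonneg _)]
  refine lintegral_congr fun x => ?_
  rw [← ofReal_norm, ← ENNReal.ofReal_pow (norm_nonneg _)]

/-- **Zooms of a field whose scaled energy at `x₀` vanishes tend to zero strongly in `L²_loc`**:
if `r⁻¹ ∫_{B(x₀,r)} ‖b‖² → 0` as `r → 0⁺` then `∫⁻_{B(0,a)} ‖R_j b(x₀ + R_j y)‖ₑ² dy → 0` as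
`R_j → 0⁺`. [folklore] -/
theorem tendsto_lintegral_ball_zoom_of_scaledEnergy {b : EuclideanSpace ℝ (Fin 3) → EuclideanSpace ℝ (Fin 3)}
    (hb2 : MemLp b 2 volume) (x₀ : EuclideanSpace ℝ (Fin 3))
    (hFE : Tendsto (fun r : ℝ => r⁻¹ * ∫ x in ball x₀ r, ‖b x‖ ^ 2) (𝓝[>] 0) (𝓝 0))
    {a : ℝ} (ha : 0 < a) {R : ℕ → ℝ} (hRpos : ∀ j, 0 < R j) (hR0 : Tendsto R atTop (𝓝 0)) :
    Tendsto (fun j => ∫⁻ y in ball (0 : EuclideanSpace ℝ (Fin 3)) a, ‖R j • b (x₀ + R j • y)‖ₑ ^ 2)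
      atTop (𝓝 0) := by
  -- `a R_j → 0⁺`
  have haR : Tendsto (fun j => a * R j) atTop (𝓝[>] 0) := by
    refine tendsto_nhdsWithin_iff.2 ⟨?_, Eventually.of_forall fun j => ?_⟩
    · simpa using hR0.const_mul a
    · exact mul_pos ha (hRpos j)
  have h1 : Tendsto (fun j => (a * R j)⁻¹ * ∫ x in ball x₀ (a * R j), ‖b x‖ ^ 2) atTop (𝓝 0) :=
    hFE.comp haR
  have h2 : Tendsto (fun j => ENNReal.ofReal (a * ((a * R j)⁻¹ * ∫ x in ball x₀ (a * R j), ‖b x‖ ^ 2)))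
      atTop (𝓝 0) := by
    have := ENNReal.tendsto_ofReal (h1.const_mul a)
    rwa [mul_zero, ENNReal.ofReal_zero] at this
  refine h2.congr fun j => ?_
  have ha0 : a ≠ 0 := ha.ne'
  have hR0' : R j ≠ 0 := (hRpos j).ne'
  rw [lintegral_ball_norm_sq_zoom b x₀ (hRpos j) a, lintegral_ball_enorm_sq_eq_ofReal hb2,
    ← ENNReal.ofReal_mul (inv_nonneg.2 (hRpos j).le)]
  congr 1
  rw [mul_inv, ← mul_assoc, ← mul_assoc, mul_inv_cancel₀ ha0, one_mul]

/-- **Pairings of the zooms tend to zero** when the scaled energy of `b ∈ L²` at `x₀` vanishes: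
for a bounded continuous `φ` supported in `B(0, a)`, `∫ ⟪R_j b(x₀ + R_j y), φ(y)⟫ dy → 0`.
[folklore] -/
theorem tendsto_integral_inner_zoom_of_scaledEnergy {b : EuclideanSpace ℝ (Fin 3) → EuclideanSpace ℝ (Fin 3)}
    (hb2 : MemLp b 2 volume) (x₀ : EuclideanSpace ℝ (Fin 3))
    (hFE : Tendsto (fun r : ℝ => r⁻¹ * ∫ x in ball x₀ r, ‖b x‖ ^ 2) (𝓝[>] 0) (𝓝 0))
    {φ : EuclideanSpace ℝ (Fin 3) → EuclideanSpace ℝ (Fin 3)} (hφc : Continuous φ) {M : ℝ}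
    (hφM : ∀ y, ‖φ y‖ ≤ M) {a : ℝ} (ha : 0 < a)
    (hφs : ∀ y, y ∉ ball (0 : EuclideanSpace ℝ (Fin 3)) a → φ y = 0)
    {R : ℕ → ℝ} (hRpos : ∀ j, 0 < R j) (hR0 : Tendsto R atTop (𝓝 0)) :
    Tendsto (fun j => ∫ y, ⟪R j • b (x₀ + R j • y), φ y⟫) atTop (𝓝 0) := by
  have hbm : AEStronglyMeasurable b volume := hb2.aestronglyMeasurable
  have hb2' : ∫⁻ x, ‖b x‖ₑ ^ 2 < ⊤ := by
    have h := lintegral_rpow_enorm_lt_top_of_eLpNorm_lt_top two_ne_zero ENNReal.ofNat_ne_top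
      hb2.eLpNorm_lt_top
    simpa only [ENNReal.toReal_ofNat, ENNReal.rpow_ofNat] using h
  have hf2 : ∀ j, ∫⁻ y in ball (0 : EuclideanSpace ℝ (Fin 3)) a, ‖R j • b (x₀ + R j • y)‖ₑ ^ 2 < ⊤ := by
    intro j
    rw [lintegral_ball_norm_sq_zoom b x₀ (hRpos j) a]
    refine ENNReal.mul_lt_top ENNReal.ofReal_lt_top ?_
    exact lt_of_le_of_lt (setLIntegral_le_lintegral _ _) hb2'
  have key := tendsto_integral_inner_of_tendsto_lintegral (μ := (volume : Measure (EuclideanSpace ℝ (Fin 3))))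
    (f := fun j y => R j • b (x₀ + R j • y)) (g := fun _ => (0 : EuclideanSpace ℝ (Fin 3))) (η := φ)
    (B := ball (0 : EuclideanSpace ℝ (Fin 3)) a)
    (fun j => aestronglyMeasurable_zoom hbm x₀ (hRpos j)) aestronglyMeasurable_const
    hφc.aestronglyMeasurable hφM measure_ball_lt_top hφs hf2 (by simp)
    (by simpa using tendsto_lintegral_ball_zoom_of_scaledEnergy hb2 x₀ hFE ha hRpos hR0)
  simpa using key

/-! ### The blow-up limit vanishes weakly at the final time -/

set_option maxHeartbeats 800000 in
/-- **The blow-up limit vanishes weakly at the final time, when the final value has no scaled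
energy concentration at the vertex.** As `ae_abs_pairing_le_near_top_of_moment`, with (FM)
replaced by (FE) `r⁻¹ ∫_{B(x₀,r)} ‖u(T)‖² → 0`.
[cite: SereginSverak2002, §4, (4.8) at t₀ (p. 80–81)] -/
theorem ae_abs_pairing_le_near_top_of_scaledEnergy (hT : 0 < T)
    (hsol : IsClassicalNSSolutionOn (Ico 0 T) 1 0 u p) (hLH : IsLerayHopfOn T 1 0 (u 0) u)
    {K : ℝ} (hK : 0 ≤ K)
    (hone : (∀ t ∈ Ioo 0 T, ∀ x, ‖u t x‖ ^ 2 / 2 + normalisedPressure (u t) x ≤ K) ∨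
      (∀ t ∈ Ioo 0 T, ∀ x, -K ≤ normalisedPressure (u t) x))
    (x₀ : EuclideanSpace ℝ (Fin 3))
    (hFE : Tendsto (fun r : ℝ => r⁻¹ * ∫ x in ball x₀ r, ‖u T x‖ ^ 2) (𝓝[>] 0) (𝓝 0))
    {R : ℕ → ℝ} (hRpos : ∀ j, 0 < R j) (hR0 : Tendsto R atTop (𝓝 0))
    {w : ℝ → EuclideanSpace ℝ (Fin 3) → EuclideanSpace ℝ (Fin 3)} {a : ℝ} (ha : 1 ≤ a)
    (hw3 : MemLp (uncurry w) 3
      (volume.restrict (parabolicCylinder a (0 : ℝ × EuclideanSpace ℝ (Fin 3)))))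
    (hconv : Tendsto (fun j => eLpNorm
        (uncurry ((R j) • stPull ((R j) ^ 2) (R j) T x₀ u) - uncurry w) 3
        (volume.restrict (parabolicCylinder a (0 : ℝ × EuclideanSpace ℝ (Fin 3)))))
      atTop (𝓝 0))
    {φ : EuclideanSpace ℝ (Fin 3) → EuclideanSpace ℝ (Fin 3)} (hφ : ContDiff ℝ ∞ φ)
    (hφc : HasCompactSupport φ) (hφa : tsupport φ ⊆ ball (0 : EuclideanSpace ℝ (Fin 3)) a)
    {η : ℝ} (hη : 0 < η) :
    ∃ δ > 0, ∀ᵐ s ∂(volume : Measure ℝ), s ∈ Ioo (-δ) 0 → |∫ y, ⟪w s y, φ y⟫| ≤ η := by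
  have ha0 : 0 < a := by linarith
  obtain ⟨C, hC0, R₀, hR₀, hmod⟩ := zoom_pairing_modulus hT hsol hLH hK hone x₀ hφ hφc ha hφa
  obtain ⟨δ, hδ, hδ1, hδC⟩ := exists_delta_modulus_le hC0 hη
  refine ⟨δ, hδ, ?_⟩
  have hφs : ∀ y, y ∉ ball (0 : EuclideanSpace ℝ (Fin 3)) a → φ y = 0 := fun y hy =>
    image_eq_zero_of_notMem_tsupport fun h => hy (hφa h)
  obtain ⟨M, hM⟩ := hφ.continuous.bounded_above_of_compact_support hφc
  obtain ⟨κ, hκ, hae⟩ := exists_subseq_ae_tendsto_pairing hT hsol x₀ hRpos hR0 hw3 hconv hφ.continuous hM hφs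
  have hTI : T ∈ Icc 0 T := ⟨hT.le, le_rfl⟩
  have hb2 : MemLp (u T) 2 volume := hLH.memLp T hTI
  have hZ : Tendsto (fun k => ∫ y, ⟪R (κ k) • u T (x₀ + R (κ k) • y), φ y⟫) atTop (𝓝 0) :=
    tendsto_integral_inner_zoom_of_scaledEnergy hb2 x₀ hFE hφ.continuous hM ha0 hφs (fun k => hRpos _)
      (hR0.comp hκ.tendsto_atTop)
  have hevR : ∀ᶠ k in atTop, R (κ k) ≤ R₀ :=
    (hR0.comp hκ.tendsto_atTop).eventually (Iic_mem_nhds hR₀)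
  have hae' := (ae_restrict_iff' measurableSet_Ioo).1 hae
  filter_upwards [hae'] with s hs hsδ
  have hsa : s ∈ Ioo (-a ^ 2) 0 := ⟨by nlinarith [hsδ.1, hδ1, ha], hsδ.2⟩
  have hs1 : s ∈ Ioo (-1 : ℝ) 0 := ⟨by linarith [hsδ.1], hsδ.2⟩
  have hsabs : |s| < δ := by rw [abs_of_neg hsδ.2]; linarith [hsδ.1]
  have hlimP := (hs hsa).abs
  have hev : ∀ᶠ k in atTop, |∫ y, ⟪R (κ k) • u (T + R (κ k) ^ 2 * s) (x₀ + R (κ k) • y), φ y⟫| ≤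
      |∫ y, ⟪R (κ k) • u T (x₀ + R (κ k) • y), φ y⟫| + C * (|s| + |s| ^ (1 / 3 : ℝ)) := by
    filter_upwards [hevR] with k hk
    have h := hmod (R (κ k)) (hRpos _) hk s hs1
    have := abs_sub_abs_le_abs_sub (∫ y, ⟪R (κ k) • u (T + R (κ k) ^ 2 * s) (x₀ + R (κ k) • y), φ y⟫)
      (∫ y, ⟪R (κ k) • u T (x₀ + R (κ k) • y), φ y⟫)
    linarith
  have hlimZ : Tendsto (fun k => |∫ y, ⟪R (κ k) • u T (x₀ + R (κ k) • y), φ y⟫| + C * (|s| + |s| ^ (1 / 3 : ℝ)))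
      atTop (𝓝 (0 + C * (|s| + |s| ^ (1 / 3 : ℝ)))) := by
    have := hZ.abs
    rw [abs_zero] at this
    exact this.add_const _
  have hle := le_of_tendsto_of_tendsto hlimP hlimZ hev
  rw [zero_add] at hle
  exact hle.trans (hδC s hsabs)

/-! ### Regularity of the final slice -/

/-- **Regularity of `(T, x₀)` under either one-sided bound when the final value has no scaled
energy concentration at `x₀`, `ν = 1`.** [cite: SereginSverak2002, Thm. 2.2 (p. 70); (4.8) at t₀] -/
theorem isBackwardBoundedAt_top_of_scaledEnergy (hT : 0 < T)
    (hsol : IsClassicalNSSolutionOn (Ico 0 T) 1 0 u p) (hLH : IsLerayHopfOn T 1 0 (u 0) u)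
    {K : ℝ} (hK : 0 ≤ K)
    (hone : (∀ t ∈ Ioo 0 T, ∀ x, ‖u t x‖ ^ 2 / 2 + normalisedPressure (u t) x ≤ K) ∨
      (∀ t ∈ Ioo 0 T, ∀ x, -K ≤ normalisedPressure (u t) x))
    (x₀ : EuclideanSpace ℝ (Fin 3))
    (hFE : Tendsto (fun r : ℝ => r⁻¹ * ∫ x in ball x₀ r, ‖u T x‖ ^ 2) (𝓝[>] 0) (𝓝 0)) :
    IsBackwardBoundedAt u T x₀ :=
  isBackwardBoundedAt_top_of_weakVanishing hT hsol hLH hK hone x₀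
    fun _ _ _ hRpos hR0 hb hw3 hconv _ hφ hφc hφa _ hη =>
      ae_abs_pairing_le_near_top_of_scaledEnergy hT hsol hLH hK hone x₀ hFE hRpos hR0 hb hw3 hconv hφ
        hφc hφa hη

/-- The scaled energy of a constant multiple vanishes with that of the field. [folklore] -/
theorem tendsto_scaledEnergy_const_smul {b : EuclideanSpace ℝ (Fin 3) → EuclideanSpace ℝ (Fin 3)}
    {x₀ : EuclideanSpace ℝ (Fin 3)}
    (hFE : Tendsto (fun r : ℝ => r⁻¹ * ∫ x in ball x₀ r, ‖b x‖ ^ 2) (𝓝[>] 0) (𝓝 0)) (c : ℝ) :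
    Tendsto (fun r : ℝ => r⁻¹ * ∫ x in ball x₀ r, ‖(c • b) x‖ ^ 2) (𝓝[>] 0) (𝓝 0) := by
  have e : ∀ r : ℝ, r⁻¹ * ∫ x in ball x₀ r, ‖(c • b) x‖ ^ 2 = c ^ 2 * (r⁻¹ * ∫ x in ball x₀ r, ‖b x‖ ^ 2) := by
    intro r
    have e1 : ∀ x, ‖(c • b) x‖ ^ 2 = c ^ 2 * ‖b x‖ ^ 2 := fun x => by
      rw [Pi.smul_apply, norm_smul, Real.norm_eq_abs, mul_pow, sq_abs]
    simp_rw [e1]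
    rw [integral_const_mul]
    ring
  simp_rw [e]
  have := hFE.const_mul (c ^ 2)
  rwa [mul_zero] at this

/-- **Regularity under either one-sided bound when the final value has no scaled energy
concentration, every viscosity and every time `t₀ ∈ (0, T]`** (viscosity rescaling to `ν = 1`;
interior times by continuity). [cite: SereginSverak2002, Thm. 2.2 (p. 70); (4.8) at t₀] -/
theorem isBackwardBoundedAt_of_scaledEnergy {ν : ℝ} (hν : 0 < ν) (hT : 0 < T)
    (hsol : IsClassicalNSSolutionOn (Ico 0 T) ν 0 u p) (hLH : IsLerayHopfOn T ν 0 (u 0) u)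
    {K : ℝ}
    (hone : (∀ t ∈ Ioo 0 T, ∀ x, ‖u t x‖ ^ 2 / 2 + normalisedPressure (u t) x ≤ K) ∨
      (∀ t ∈ Ioo 0 T, ∀ x, -K ≤ normalisedPressure (u t) x))
    (hFE : ∀ x₀ : EuclideanSpace ℝ (Fin 3),
      Tendsto (fun r : ℝ => r⁻¹ * ∫ x in ball x₀ r, ‖u T x‖ ^ 2) (𝓝[>] 0) (𝓝 0))
    {t₀ : ℝ} (ht₀ : t₀ ∈ Ioc 0 T) (x₀ : EuclideanSpace ℝ (Fin 3)) : IsBackwardBoundedAt u t₀ x₀ := by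
  -- interior times: continuity
  rcases lt_or_eq_of_le ht₀.2 with hlt | rfl
  · exact IsBackwardBoundedAt.of_continuousOn (continuousOn_uncurry hsol) ⟨ht₀.1, hlt⟩ x₀
  -- the final time: rescale to viscosity one
  have hν0 : ν ≠ 0 := hν.ne'
  have hνi : 0 < ν⁻¹ := inv_pos.2 hν
  have hνT : 0 < ν * t₀ := mul_pos hν hT
  set v : ℝ → EuclideanSpace ℝ (Fin 3) → EuclideanSpace ℝ (Fin 3) := timeRescale ν⁻¹ ν⁻¹ u with hv
  set π' : ℝ → EuclideanSpace ℝ (Fin 3) → ℝ := timeRescale ν⁻¹ (ν⁻¹ ^ 2) p with hπ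
  have hslice : ∀ s, v s = ν⁻¹ • u (ν⁻¹ * s) := fun s => rfl
  have hmaps : MapsTo (fun s => ν⁻¹ * s) (Ico 0 (ν * t₀)) (Ico 0 t₀) := by
    intro s hs'
    refine ⟨mul_nonneg hνi.le hs'.1, ?_⟩
    calc ν⁻¹ * s < ν⁻¹ * (ν * t₀) := mul_lt_mul_of_pos_left hs'.2 hνi
      _ = t₀ := by rw [← mul_assoc, inv_mul_cancel₀ hν0, one_mul]
  have hs' : IsClassicalNSSolutionOn (Ico 0 (ν * t₀)) 1 0 v π' := by
    have := hsol.viscosityRescale_set hν0 hmaps (uniqueDiffOn_Ico 0 (ν * t₀))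
    rwa [timeRescale_zero_force] at this
  have hv0 : v 0 = ν⁻¹ • u 0 := by rw [hslice, mul_zero]
  have hLH' : IsLerayHopfOn (ν * t₀) 1 0 (v 0) v := by
    have := hLH.viscosityRescale hνi
    rw [div_inv_eq_mul, mul_comm t₀ ν, inv_mul_cancel₀ hν0, timeRescale_zero_force] at this
    rwa [hv0]
  have hpress : ∀ s x, normalisedPressure (v s) x = ν⁻¹ ^ 2 * normalisedPressure (u (ν⁻¹ * s)) x :=
    fun s x => by rw [hslice, normalisedPressure_smul]
  have hnorm : ∀ s x, ‖v s x‖ ^ 2 = ν⁻¹ ^ 2 * ‖u (ν⁻¹ * s) x‖ ^ 2 := fun s x => by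
    rw [hslice, Pi.smul_apply, norm_smul, Real.norm_eq_abs, abs_of_pos hνi]; ring
  have hone' : (∀ s ∈ Ioo 0 (ν * t₀), ∀ x, ‖v s x‖ ^ 2 / 2 + normalisedPressure (v s) x ≤ ν⁻¹ ^ 2 * |K|) ∨
      (∀ s ∈ Ioo 0 (ν * t₀), ∀ x, -(ν⁻¹ ^ 2 * |K|) ≤ normalisedPressure (v s) x) := by
    rcases hone with hhead | hfloor
    · refine Or.inl fun s hs'' x => ?_
      have ht : ν⁻¹ * s ∈ Ioo 0 t₀ := (inv_mul_mem_Ioo_iff hν).2 hs''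
      have h1 := hhead _ ht x
      have h2 : ‖u (ν⁻¹ * s) x‖ ^ 2 / 2 + normalisedPressure (u (ν⁻¹ * s)) x ≤ |K| :=
        h1.trans (le_abs_self K)
      have := mul_le_mul_of_nonneg_left h2 (sq_nonneg ν⁻¹)
      rw [hpress, hnorm]
      linarith
    · refine Or.inr fun s hs'' x => ?_
      have ht : ν⁻¹ * s ∈ Ioo 0 t₀ := (inv_mul_mem_Ioo_iff hν).2 hs''
      have h1 := hfloor _ ht x
      have h2 : -|K| ≤ normalisedPressure (u (ν⁻¹ * s)) x := (neg_le_neg (le_abs_self K)).trans h1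
      have := mul_le_mul_of_nonneg_left h2 (sq_nonneg ν⁻¹)
      rw [hpress]
      linarith
  -- (FE) rescales
  have hvT : v (ν * t₀) = ν⁻¹ • u t₀ := by
    rw [hslice, ← mul_assoc, inv_mul_cancel₀ hν0, one_mul]
  have hFE' : Tendsto (fun r : ℝ => r⁻¹ * ∫ x in ball x₀ r, ‖v (ν * t₀) x‖ ^ 2) (𝓝[>] 0) (𝓝 0) := by
    rw [hvT]
    exact tendsto_scaledEnergy_const_smul (hFE x₀) ν⁻¹
  have hb := isBackwardBoundedAt_top_of_scaledEnergy hνT hs' hLH' (by positivity : (0 : ℝ) ≤ ν⁻¹ ^ 2 * |K|)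
    hone' x₀ hFE'
  -- transport back: radius `r / max 1 ν`
  obtain ⟨r, hr, C, hC⟩ := hb
  set m : ℝ := max 1 ν with hm
  have hm1 : 1 ≤ m := le_max_left _ _
  have hmν : ν ≤ m := le_max_right _ _
  have hm0 : 0 < m := by positivity
  refine ⟨r / m, by positivity, ν * C, fun t ht x hx => ?_⟩
  have hrm : r / m ≤ r := div_le_self hr.le hm1
  have hts : ν * t ∈ Ioo (ν * t₀ - r ^ 2) (ν * t₀) := by
    constructor
    · have h1 : ν * (t₀ - t) < ν * (r / m) ^ 2 := mul_lt_mul_of_pos_left (by linarith [ht.1]) hν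
      have hsq : ν * (r / m) ^ 2 ≤ r ^ 2 := by
        rw [div_pow]
        have hm2 : ν ≤ m ^ 2 := hmν.trans (by nlinarith)
        calc ν * (r ^ 2 / m ^ 2) = ν / m ^ 2 * r ^ 2 := by ring
          _ ≤ 1 * r ^ 2 := by
              refine mul_le_mul_of_nonneg_right ?_ (sq_nonneg r)
              rw [div_le_one (by positivity)]; exact hm2
          _ = r ^ 2 := one_mul _
      nlinarith
    · exact mul_lt_mul_of_pos_left ht.2 hν
  have hxs : x ∈ ball x₀ r := ball_subset_ball hrm hx
  have key := hC (ν * t) hts x hxs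
  rw [hslice, Pi.smul_apply, ← mul_assoc, inv_mul_cancel₀ hν0, one_mul, norm_smul,
    Real.norm_eq_abs, abs_of_pos hνi] at key
  exact (inv_mul_le_iff₀ hν).1 key

/-- **Seregin–Šverák 2002, Thm. 2.2, the final-time input in its weakest explicit form.** Let
`ν > 0`, `T > 0`, `(u, p)` a classical solution of the unforced Navier–Stokes system on
`ℝ³ × [0, T)`, Leray–Hopf on `[0, T]` from its rapidly decaying datum. Assume EITHER
`|u|²/2 + p̃ ≤ K` on `(0, T) × ℝ³` OR `p̃ ≥ -K` there, AND that the final value has no scaled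
energy concentration: `r⁻¹ ∫_{B(x₀,r)} ‖u(T,x)‖² dx → 0` as `r → 0⁺`, for every `x₀` — which is
what the printed proof extracts from its hypothesis at the singular time ((4.8) at `t₀`,
p. 80–81; (4.13), p. 84). Then `u` is bounded on `(δ, T) × ℝ³` for every `δ ∈ (0, T)`.
[cite: SereginSverak2002, Thm. 2.2 (p. 70), proof §4 pp. 76–84] -/
theorem _root_.Literature.Analysis.FluidPDE.seregin_sverak_2002_of_finalScaledEnergy :
    ∀ (ν T : ℝ), 0 < ν → 0 < T →
    ∀ (u : ℝ → EuclideanSpace ℝ (Fin 3) → EuclideanSpace ℝ (Fin 3)) (p : ℝ → EuclideanSpace ℝ (Fin 3) → ℝ),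
      IsClassicalNSSolutionOn (Ico 0 T) ν 0 u p →
      IsLerayHopfOn T ν 0 (u 0) u →
      HasRapidSpatialDecay (u 0) →
      ((∃ K : ℝ, ∀ t ∈ Ioo 0 T, ∀ x, ‖u t x‖ ^ 2 / 2 + normalisedPressure (u t) x ≤ K) ∨
        (∃ K : ℝ, ∀ t ∈ Ioo 0 T, ∀ x, -K ≤ normalisedPressure (u t) x)) →
      (∀ x₀ : EuclideanSpace ℝ (Fin 3),
        Tendsto (fun r : ℝ => r⁻¹ * ∫ x in ball x₀ r, ‖u T x‖ ^ 2) (𝓝[>] 0) (𝓝 0)) →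
      ∀ δ ∈ Ioo 0 T, ∃ M : ℝ, ∀ t ∈ Ioo δ T, ∀ x, ‖u t x‖ ≤ M := by
  intro ν T hν hT u p hsol hLH _ hone hFE δ hδ
  have hone' : ∃ K : ℝ, (∀ t ∈ Ioo 0 T, ∀ x, ‖u t x‖ ^ 2 / 2 + normalisedPressure (u t) x ≤ K) ∨
      (∀ t ∈ Ioo 0 T, ∀ x, -K ≤ normalisedPressure (u t) x) := by
    rcases hone with ⟨K, hK⟩ | ⟨K, hK⟩
    · exact ⟨K, Or.inl hK⟩
    · exact ⟨K, Or.inr hK⟩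
  obtain ⟨K, hK⟩ := hone'
  have hloc : ∀ x₀ : EuclideanSpace ℝ (Fin 3), IsBackwardBoundedAt u T x₀ := fun x₀ =>
    isBackwardBoundedAt_of_scaledEnergy hν hT hsol hLH hK hFE ⟨hT, le_rfl⟩ x₀
  obtain ⟨R, M₁, hfar⟩ := farField_bound hν hT hsol hLH hδ.1
  obtain ⟨M₂, hnear⟩ := nearField_bound hT (continuousOn_uncurry hsol) hloc hδ.1 R
  refine ⟨max M₁ M₂, fun t ht x => ?_⟩
  by_cases hx : ‖x‖ ≤ R
  · exact (hnear (t, x) ⟨⟨ht.1.le, ht.2.le⟩, mem_closedBall_zero_iff.2 hx⟩ ht.2).trans (le_max_right _ _)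
  · exact (hfar t ht x (not_le.1 hx)).trans (le_max_left _ _)

end SereginSverak2002

end Literature.Analysis.FluidPDE

end
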